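import Literature.NumberTheory.Sieve.LuGoldbachExceptionalSet
import HarnessLib

/-!
# Lu (2010) / Montgomery–Vaughan (1975): proofs above the major-arc input

Theorems only (no definitions, no named facts), on top of
`Literature/NumberTheory/Sieve/LuGoldbachExceptionalSet.lean`, where the minor-arc input A of the
circle-method treatment of the Goldbach exceptional set is proved outright
(`Literature.NumberTheory.Sieve.Lu2010.minorArc_meanSquare_of_level_holds`) and `E(x) ≪ x^σ` is reduced to the single
major-arc input `Literature.Lu2010.MajorArcLowerBoundOffSmallSet σ`
(`Literature.NumberTheory.Sieve.goldbachExceptionalCount_isBigO_rpow_of_majorArc`).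

* `Literature.NumberTheory.Sieve.Lu2010.majorArcLowerBoundOffSmallSet_of_mv` — Montgomery–Vaughan's major-arc theorem
  (8.3) (the named fact `Literature.NumberTheory.Sieve.MontgomeryVaughan1975.majorArc_lowerBound`: level `P = X^{6δ}`,
  threshold and exception count `X P^{-1/3}`, window `(X/2, X]`) is an instance of input B(σ) for
  every `σ > 1 - 2δ` [MontgomeryVaughanActa1975]. This substantiates, on the one instance of the
  method present in the tree, that B(σ) is the method's output in the form consumed by the
  counting argument (Li, Acta Arith. 92 (2000), §6 [Li2000]; Lu, J. Number Theory 130 (2010)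
  [LuJNT2010] are the instances `σ = 0.914`, `σ = 0.879`).
* `Literature.NumberTheory.Sieve.goldbachExceptionalCount_isBigO_rpow_of_majorArc_mv` — hence Montgomery–Vaughan
  1975, Theorem 1 (`goldbachExceptionalCount_isBigO_rpow`: `E(x) ≪ x^{1-δ}` for some `δ > 0`)
  follows from their major-arc theorem ALONE, the minor arcs being unconditional; this is
  `Literature.NumberTheory.Sieve.goldbachExceptionalCount_isBigO_rpow_of_mv83` with its Vinogradov hypothesis
  discharged, by a second route (window ratio `1 - ε`, geometric summation).
-/

noncomputable section

open Filter Asymptotics Finset MeasureTheory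

/-! ### Montgomery–Vaughan's (8.3) is an instance of input B(σ) -/

namespace Literature.NumberTheory.Sieve.Lu2010

open MontgomeryVaughan1975

/-- **Montgomery–Vaughan's major-arc theorem is an instance of input B(σ).** Their (8.3) (the
named fact `Literature.NumberTheory.Sieve.MontgomeryVaughan1975.majorArc_lowerBound`: level `P = X^{6δ}`, threshold and
exception count `X P^{-1/3} = X^{1-2δ}`, window `(X/2, X]`, every `0 < δ ≤ δ₀`) gives
`MajorArcLowerBoundOffSmallSet σ` for every `σ > 1 - 2δ`, with `δ = min δ₀ (1/48)`, `ε = 1/2`,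
`θ = 6δ ≤ 1/8`, `κ = 2δ` (so `1 - θ + 2κ = 1 - 2δ < σ`). This substantiates, on the one instance of
the method present in the tree, that B(σ) is the method's output in the form consumed by the
counting argument. [cite: MontgomeryVaughanActa1975, §8 (8.3)] -/
theorem majorArcLowerBoundOffSmallSet_of_mv (h83 : majorArc_lowerBound) :
    ∃ δ : ℝ, 0 < δ ∧ ∀ σ : ℝ, 1 - 2 * δ < σ → MajorArcLowerBoundOffSmallSet σ := by
  obtain ⟨δ₀, hδ₀, C, hC⟩ := h83
  set δ : ℝ := min δ₀ (1 / 48) with hδ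
  have hδpos : 0 < δ := lt_min hδ₀ (by norm_num)
  have hδle : δ ≤ δ₀ := min_le_left _ _
  have hδ48 : δ ≤ 1 / 48 := min_le_right _ _
  obtain ⟨X₀, hX₀⟩ := hC δ hδpos hδle
  refine ⟨δ, hδpos, fun σ hσ => ?_⟩
  refine ⟨1 / 2, 6 * δ, 2 * δ, by norm_num, le_rfl, by linarith, by linarith, by linarith,
    by linarith, max C 0, max X₀ 1, fun X hX => ?_⟩
  have hX1 : 1 ≤ X := (le_max_right _ _).trans hX
  have hX0 : 0 < X := by linarith
  have hXX₀ : X₀ ≤ X := (le_max_left _ _).trans hX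
  -- the threshold and the exception count of (8.3): `X (X^{6δ})^{-1/3} = X^{1-2δ}`
  have hthr : X * (X ^ (6 * δ)) ^ (-(1 / 3 : ℝ)) = X ^ (1 - 2 * δ) := by
    rw [← Real.rpow_mul hX0.le, show 6 * δ * (-(1 / 3 : ℝ)) = -(2 * δ) by ring,
      show (1 : ℝ) - 2 * δ = 1 + -(2 * δ) by ring, Real.rpow_add hX0, Real.rpow_one]
  have hR : C * X * (X ^ (6 * δ)) ^ (-(1 / 3 : ℝ)) = C * X ^ (1 - 2 * δ) := by
    rw [mul_assoc, hthr]
  have h := hX₀ X hXX₀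
  rw [hR, hthr] at h
  -- the window `(1 - 1/2) X < n` is Montgomery–Vaughan's `X/2 < n`
  have hset : ((Finset.Icc 1 ⌊X⌋₊).filter fun n : ℕ => (1 - 1 / 2) * X < n ∧ Even n ∧
        (majorArcIntegral (X ^ (6 * δ)) (X ^ (1 - 6 * δ)) X n).re ≤ X ^ (1 - 2 * δ)) =
      ((Finset.Icc 1 ⌊X⌋₊).filter fun n : ℕ => X / 2 < n ∧ Even n ∧
        (majorArcIntegral (X ^ (6 * δ)) (X ^ (1 - 6 * δ)) X n).re ≤ X ^ (1 - 2 * δ)) := by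
    refine Finset.filter_congr fun n _ => ?_
    rw [show (1 - 1 / 2) * X = X / 2 by ring]
  rw [hset]
  calc _ ≤ C * X ^ (1 - 2 * δ) := h
    _ ≤ max C 0 * X ^ (1 - 2 * δ) :=
        mul_le_mul_of_nonneg_right (le_max_left _ _) (Real.rpow_nonneg hX0.le _)
    _ ≤ max C 0 * X ^ σ :=
        mul_le_mul_of_nonneg_left (Real.rpow_le_rpow_of_exponent_le hX1 hσ.le) (le_max_right _ _)

end Literature.NumberTheory.Sieve.Lu2010

namespace Literature.NumberTheory.Sieve

open Lu2010 MontgomeryVaughan1975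

/-- **Montgomery–Vaughan 1975, Theorem 1, from their major-arc theorem alone**:
`majorArc_lowerBound → goldbachExceptionalCount_isBigO_rpow` (`E(x) ≪ x^{1-δ}` for some `δ > 0`),
through input B(σ) at `σ = 1 - δ` (`majorArcLowerBoundOffSmallSet_of_mv`) and the unconditional
minor arcs (`goldbachExceptionalCount_isBigO_rpow_of_majorArc`); the same conclusion as
`goldbachExceptionalCount_isBigO_rpow_of_mv83` with its Vinogradov hypothesis discharged.
[cite: MontgomeryVaughanActa1975, Theorem 1 and §8] -/
theorem goldbachExceptionalCount_isBigO_rpow_of_majorArc_mv (h83 : majorArc_lowerBound) :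
    goldbachExceptionalCount_isBigO_rpow := by
  obtain ⟨δ, hδ, hB⟩ := majorArcLowerBoundOffSmallSet_of_mv h83
  exact ⟨δ, hδ, goldbachExceptionalCount_isBigO_rpow_of_majorArc (hB (1 - δ) (by linarith))⟩

end Literature.NumberTheory.Sieve

/-! ### The envelope of input B(σ)

Three elementary facts about the SHAPE of `Literature.NumberTheory.Sieve.Lu2010.MajorArcLowerBoundOffSmallSet σ`
as vendored (they do not touch its analytic content): it is monotone in `σ`; it forces `σ > 3/4`
(the level is capped at `θ ≤ 1/4`, so that `P + 1 ≤ Q` and (3.1) of Montgomery–Vaughan applies);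
and it holds trivially for `σ ≥ 1` (the window `((1-ε)X, X]` has at most `⌊X⌋ ≤ X` members). The
method's content is therefore exactly the range `3/4 < σ < 1`: Montgomery–Vaughan's `1 - 2δ`
(`majorArcLowerBoundOffSmallSet_of_mv`), Li's `0.914` (Acta Arith. 92 (2000) §6 [Li2000]), Lu's
`0.879` (J. Number Theory 130 (2010), Theorem 1 [LuJNT2010]; the hypothesis of
`Literature.NumberTheory.Sieve.goldbachExceptionalCount_isBigO_rpow_lu_of_majorArc`); exponents
`≤ 3/4` (Pintz, arXiv:1804.09084: `0.72`) are out of reach of this currency by design, not by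
depth. -/

namespace Literature.NumberTheory.Sieve.Lu2010

open MontgomeryVaughan1975

/-- Input B(σ) is monotone in the exponent: an exceptional set of size `≤ C X^σ` (`X ≥ X₀`) is one
of size `≤ max(C,0) X^{σ'}` for `σ ≤ σ'` and `X ≥ max(X₀,1)`, with the same window, level and
saving. [folklore] -/
theorem MajorArcLowerBoundOffSmallSet.mono {σ σ' : ℝ} (hle : σ ≤ σ')
    (h : MajorArcLowerBoundOffSmallSet σ) : MajorArcLowerBoundOffSmallSet σ' := by
  obtain ⟨ε, θ, κ, hε, hε2, hθ, hθ4, hκ, hσ, C, X₀, hC⟩ := h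
  refine ⟨ε, θ, κ, hε, hε2, hθ, hθ4, hκ, hσ.trans_le hle, max C 0, max X₀ 1, fun X hX => ?_⟩
  have hX1 : 1 ≤ X := (le_max_right _ _).trans hX
  have hX0 : 0 ≤ X := zero_le_one.trans hX1
  calc _ ≤ C * X ^ σ := hC X ((le_max_left _ _).trans hX)
    _ ≤ max C 0 * X ^ σ :=
        mul_le_mul_of_nonneg_right (le_max_left _ _) (Real.rpow_nonneg hX0 _)
    _ ≤ max C 0 * X ^ σ' :=
        mul_le_mul_of_nonneg_left (Real.rpow_le_rpow_of_exponent_le hX1 hle) (le_max_right _ _)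

/-- Input B at Lu's exponent `σ = 0.879` (the hypothesis of
`Literature.NumberTheory.Sieve.goldbachExceptionalCount_isBigO_rpow_lu_of_majorArc`) gives input B(σ) for every
`σ ≥ 0.879`, hence (with `Literature.NumberTheory.Sieve.goldbachExceptionalCount_isBigO_rpow_of_majorArc`)
`E(x) ≪ x^σ` for all such `σ`. [folklore] -/
theorem majorArcLowerBoundOffSmallSet_of_lu (hB : MajorArcLowerBoundOffSmallSet 0.879) {σ : ℝ}
    (hσ : 0.879 ≤ σ) : MajorArcLowerBoundOffSmallSet σ :=
  MajorArcLowerBoundOffSmallSet.mono hσ hB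

/-- The level cap `θ ≤ 1/4` built into input B(σ) forces `σ > 3/4`:
`σ > 1 - θ + 2κ ≥ 3/4 + 2κ > 3/4`. In particular the vendored currency cannot express
exceptional-set exponents `≤ 3/4`; those need major arcs of level `> 1/4`. [folklore] -/
theorem MajorArcLowerBoundOffSmallSet.three_quarters_lt {σ : ℝ}
    (h : MajorArcLowerBoundOffSmallSet σ) : 3 / 4 < σ := by
  obtain ⟨_, θ, κ, -, -, -, hθ4, hκ, hσ, -⟩ := h
  linarith

/-- Input B(σ) is trivial for `σ ≥ 1`: whatever the arcs, the counted set lies in `[1, X] ∩ ℕ`,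
which has `⌊X⌋ ≤ X ≤ X^σ` members for `X ≥ 1`; take `ε = 1/2`, `θ = 1/4`, `κ = 1/16`
(`1 - θ + 2κ = 7/8 < 1 ≤ σ`), `C = X₀ = 1`. (Non-vacuity of the vendored shape; the method's
content starts below `σ = 1`.) [folklore] -/
theorem MajorArcLowerBoundOffSmallSet.of_one_le {σ : ℝ} (hσ : 1 ≤ σ) :
    MajorArcLowerBoundOffSmallSet σ := by
  refine ⟨1 / 2, 1 / 4, 1 / 16, by norm_num, le_rfl, by norm_num, le_rfl, by norm_num,
    by linarith, 1, 1, fun X hX => ?_⟩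
  have hX0 : 0 ≤ X := zero_le_one.trans hX
  refine (Nat.cast_le.mpr (Finset.card_filter_le _ _)).trans ?_
  rw [Nat.card_Icc, Nat.add_sub_cancel, one_mul]
  calc (⌊X⌋₊ : ℝ) ≤ X := Nat.floor_le hX0
    _ = X ^ (1 : ℝ) := (Real.rpow_one X).symm
    _ ≤ X ^ σ := Real.rpow_le_rpow_of_exponent_le hX hσ

/-! ### Input B(σ) is the weighted Goldbach lower bound off a small set

Because the minor arcs are unconditional at every level `θ ≤ 1/4`
(`Literature.NumberTheory.Sieve.Lu2010.minorArc_meanSquare_of_level_holds`) and `R(n) = Re R₁(n) + Re R₂(n)` ((3.1) of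
Montgomery–Vaughan), input B(σ) does not really depend on the arc dissection: it is implied by —
and implies — a lower bound `R(n) ≫ X^{1-κ}` for the weighted Goldbach count
`R(n) = ∑_{P < p, p' ≤ X, p + p' = n} log p log p'` off `≪ X^σ` even `n ∈ ((1-ε)X, X]`. So any
treatment of the major arcs (Lu's own level, arcs and truncation height included) that ends in
such a lower bound discharges B(σ) through `majorArcLowerBoundOffSmallSet_of_coeffR`; no
comparison of arc systems is needed. (Li 2000 §6 and Montgomery–Vaughan 1975 §8 run this step in
the direction arcs ⇒ `R(n) > 0` only.) -/

/-- **B(σ) from a weighted Goldbach lower bound off a small set.** If for some window ratio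
`1 - ε` (`0 < ε ≤ 1/2`), level `0 < θ ≤ 1/4` and saving `κ > 0` with `1 - θ + 2κ < σ` the number
of even `n ∈ ((1-ε)X, X]` with `R(n) ≤ 2 X^{1-κ}` is at most `C X^σ` for `X ≥ X₀`
(`R(n) = coeffR (X^θ) X n`, primes `X^θ < p ≤ X`), then `MajorArcLowerBoundOffSmallSet σ` holds with
the same `ε, θ, κ`: an even `n` in the window with `Re R₁(n) ≤ X^{1-κ}` has `R(n) ≤ 2X^{1-κ}` or
`|R₂(n)| ≥ Re R₂(n) = R(n) - Re R₁(n) > X^{1-κ}`, and the latter happens for at most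
`X^{1-θ+2κ+η} = X^σ` integers `n ≤ X` (input A with `η = σ - (1-θ+2κ)`, and Chebyshev's
inequality `card_filter_lt_norm_le_of_sum_sq_le`). [cite: MontgomeryVaughanActa1975, §3 (3.1) and §8 (8.1)–(8.2)] -/
theorem majorArcLowerBoundOffSmallSet_of_coeffR {σ ε θ κ C X₀ : ℝ} (hε : 0 < ε) (hε2 : ε ≤ 1 / 2)
    (hθ : 0 < θ) (hθ4 : θ ≤ 1 / 4) (hκ : 0 < κ) (hσ : 1 - θ + 2 * κ < σ)
    (h : ∀ X : ℝ, X₀ ≤ X →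
      (((Finset.Icc 1 ⌊X⌋₊).filter fun n : ℕ => (1 - ε) * X < n ∧ Even n ∧
          coeffR (X ^ θ) X n ≤ 2 * X ^ (1 - κ)).card : ℝ) ≤ C * X ^ σ) :
    MajorArcLowerBoundOffSmallSet σ := by
  -- the loss `η` in input A is chosen so that `1 - θ + 2κ + η = σ`
  set η : ℝ := σ - (1 - θ + 2 * κ) with hη
  have hη0 : 0 < η := by rw [hη]; linarith
  obtain ⟨X₁, hAX⟩ := minorArc_meanSquare_of_level_holds θ hθ hθ4 η hη0
  refine ⟨ε, θ, κ, hε, hε2, hθ, hθ4, hκ, hσ, C + 1, max (max X₀ X₁) 4, fun X hX => ?_⟩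
  have hXX₀ : X₀ ≤ X := ((le_max_left _ _).trans (le_max_left _ _)).trans hX
  have hXX₁ : X₁ ≤ X := ((le_max_right _ _).trans (le_max_left _ _)).trans hX
  have hX4 : 4 ≤ X := (le_max_right _ _).trans hX
  have hX0 : 0 < X := by linarith
  -- the parameters
  set P : ℝ := X ^ θ with hP
  set Q : ℝ := X ^ (1 - θ) with hQ
  have hQ0 : 0 < Q := Real.rpow_pos_of_pos hX0 _
  have hPQ : P + 1 ≤ Q := rpow_add_one_le_rpow_one_sub hX4 hθ.le hθ4
  -- the two covering sets
  set B₀ : Finset ℕ := (Finset.Icc 1 ⌊X⌋₊).filter fun n : ℕ =>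
    (1 - ε) * X < n ∧ Even n ∧ coeffR P X n ≤ 2 * X ^ (1 - κ) with hB₀
  set B₁ : Finset ℕ := (Finset.Icc 1 ⌊X⌋₊).filter fun n : ℕ =>
    X ^ (1 - κ) < ‖minorArcIntegral P Q X n‖ with hB₁
  have hB₀card : (B₀.card : ℝ) ≤ C * X ^ σ := h X hXX₀
  have hB₁card : (B₁.card : ℝ) ≤ X ^ σ := by
    have h₁ := card_filter_lt_norm_le_of_sum_sq_le (κ := κ) hX0 (hAX X hXX₁)
    have hexp : 1 - θ + 2 * κ + η = σ := by rw [hη]; ring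
    rwa [hexp] at h₁
  -- the bad set of B(σ) is covered by `B₀ ∪ B₁`, by (3.1)
  have hsub : ((Finset.Icc 1 ⌊X⌋₊).filter fun n : ℕ => (1 - ε) * X < n ∧ Even n ∧
      (majorArcIntegral P Q X n).re ≤ X ^ (1 - κ)) ⊆ B₀ ∪ B₁ := by
    intro n hn
    rw [Finset.mem_filter] at hn
    obtain ⟨hnI, hnX, hne, hre⟩ := hn
    rw [Finset.mem_union]
    by_cases hc : coeffR P X n ≤ 2 * X ^ (1 - κ)
    · left
      rw [hB₀, Finset.mem_filter]
      exact ⟨hnI, hnX, hne, hc⟩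
    · right
      rw [hB₁, Finset.mem_filter]
      refine ⟨hnI, ?_⟩
      have hsum := congrArg Complex.re (coeffR_eq_add X n hQ0 hPQ)
      rw [Complex.ofReal_re, Complex.add_re] at hsum
      have h2 : (minorArcIntegral P Q X n).re ≤ ‖minorArcIntegral P Q X n‖ :=
        (abs_le.mp (Complex.abs_re_le_norm _)).2
      have hc := not_le.mp hc
      linarith
  calc _ ≤ ((B₀ ∪ B₁).card : ℝ) := by exact_mod_cast Finset.card_le_card hsub
    _ ≤ (B₀.card : ℝ) + B₁.card := by exact_mod_cast Finset.card_union_le B₀ B₁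
    _ ≤ C * X ^ σ + X ^ σ := add_le_add hB₀card hB₁card
    _ = (C + 1) * X ^ σ := by ring

/-- **The weighted Goldbach lower bound off a small set from B(σ)** (the converse of
`majorArcLowerBoundOffSmallSet_of_coeffR`, up to halving the threshold): if
`MajorArcLowerBoundOffSmallSet σ` holds with window ratio `1 - ε`, level `θ` and saving `κ`, then
for `X ≥ X₀'` all even `n ∈ ((1-ε)X, X]` but at most `C' X^σ` of them have
`R(n) > X^{1-κ}/2` (`R(n) = coeffR (X^θ) X n`). Indeed off the bad set of B(σ) and off the
`≤ X^σ` integers with `|R₂(n)| > X^{1-κ₁}` (`κ < κ₁`, `1 - θ + 2κ₁ < σ` still, input A and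
Chebyshev), `R(n) = Re R₁(n) + Re R₂(n) > X^{1-κ} - X^{1-κ₁} ≥ X^{1-κ}/2` once `X^{κ₁-κ} ≥ 2`.
Together with `majorArcLowerBoundOffSmallSet_of_coeffR`: B(σ) is exactly a power-saving lower
bound for the weighted Goldbach count off `≪ X^σ` exceptions, i.e. the conclusion of the
major-arc analysis of Li 2000 §6 / Lu 2010 in arc-free form.
[cite: MontgomeryVaughanActa1975, §3 (3.1) and §8 (8.1)–(8.2)] -/
theorem MajorArcLowerBoundOffSmallSet.coeffR_lowerBound {σ : ℝ}
    (hB : MajorArcLowerBoundOffSmallSet σ) :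
    ∃ ε θ κ : ℝ, 0 < ε ∧ ε ≤ 1 / 2 ∧ 0 < θ ∧ θ ≤ 1 / 4 ∧ 0 < κ ∧ 1 - θ + 2 * κ < σ ∧
      ∃ C X₀ : ℝ, ∀ X : ℝ, X₀ ≤ X →
        (((Finset.Icc 1 ⌊X⌋₊).filter fun n : ℕ => (1 - ε) * X < n ∧ Even n ∧
            coeffR (X ^ θ) X n ≤ X ^ (1 - κ) / 2).card : ℝ) ≤ C * X ^ σ := by
  obtain ⟨ε, θ, κ, hε, hε2, hθ, hθ4, hκ, hσ, C, X₀, hBX⟩ := hB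
  -- a slightly larger saving `κ₁` for the minor arcs, and the matching loss `η`
  set κ₁ : ℝ := κ + (σ - (1 - θ + 2 * κ)) / 4 with hκ₁
  have hκκ₁ : κ < κ₁ := by rw [hκ₁]; linarith
  have hσ₁ : 1 - θ + 2 * κ₁ < σ := by rw [hκ₁]; linarith
  set η : ℝ := σ - (1 - θ + 2 * κ₁) with hη
  have hη0 : 0 < η := by rw [hη]; linarith
  obtain ⟨X₁, hAX⟩ := minorArc_meanSquare_of_level_holds θ hθ hθ4 η hη0
  -- `X₂ = 2^{1/(κ₁-κ)}`, beyond which `X^{κ₁-κ} ≥ 2`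
  set X₂ : ℝ := (2 : ℝ) ^ (1 / (κ₁ - κ)) with hX₂
  refine ⟨ε, θ, κ, hε, hε2, hθ, hθ4, hκ, hσ, C + 1, max (max X₀ X₁) (max X₂ 4), fun X hX => ?_⟩
  have hXX₀ : X₀ ≤ X := ((le_max_left _ _).trans (le_max_left _ _)).trans hX
  have hXX₁ : X₁ ≤ X := ((le_max_right _ _).trans (le_max_left _ _)).trans hX
  have hXX₂ : X₂ ≤ X := ((le_max_left _ _).trans (le_max_right _ _)).trans hX
  have hX4 : 4 ≤ X := ((le_max_right _ _).trans (le_max_right _ _)).trans hX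
  have hX0 : 0 < X := by linarith
  -- `X^{1-κ₁} ≤ X^{1-κ}/2`
  have hpow2 : (2 : ℝ) ≤ X ^ (κ₁ - κ) := by
    have hd : 0 < κ₁ - κ := sub_pos.mpr hκκ₁
    calc (2 : ℝ) = X₂ ^ (κ₁ - κ) := by
          rw [hX₂, ← Real.rpow_mul zero_le_two, one_div_mul_cancel hd.ne', Real.rpow_one]
      _ ≤ X ^ (κ₁ - κ) := Real.rpow_le_rpow (Real.rpow_nonneg zero_le_two _) hXX₂ hd.le
  have hthr : X ^ (1 - κ₁) ≤ X ^ (1 - κ) / 2 := by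
    rw [le_div_iff₀ two_pos]
    calc X ^ (1 - κ₁) * 2 ≤ X ^ (1 - κ₁) * X ^ (κ₁ - κ) :=
          mul_le_mul_of_nonneg_left hpow2 (Real.rpow_nonneg hX0.le _)
      _ = X ^ (1 - κ) := by rw [← Real.rpow_add hX0]; ring_nf
  -- the parameters
  set P : ℝ := X ^ θ with hP
  set Q : ℝ := X ^ (1 - θ) with hQ
  have hQ0 : 0 < Q := Real.rpow_pos_of_pos hX0 _
  have hPQ : P + 1 ≤ Q := rpow_add_one_le_rpow_one_sub hX4 hθ.le hθ4
  -- the two covering sets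
  set B₂ : Finset ℕ := (Finset.Icc 1 ⌊X⌋₊).filter fun n : ℕ =>
    (1 - ε) * X < n ∧ Even n ∧ (majorArcIntegral P Q X n).re ≤ X ^ (1 - κ) with hB₂
  set B₁ : Finset ℕ := (Finset.Icc 1 ⌊X⌋₊).filter fun n : ℕ =>
    X ^ (1 - κ₁) < ‖minorArcIntegral P Q X n‖ with hB₁
  have hB₂card : (B₂.card : ℝ) ≤ C * X ^ σ := hBX X hXX₀
  have hB₁card : (B₁.card : ℝ) ≤ X ^ σ := by
    have h₁ := card_filter_lt_norm_le_of_sum_sq_le (κ := κ₁) hX0 (hAX X hXX₁)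
    have hexp : 1 - θ + 2 * κ₁ + η = σ := by rw [hη]; ring
    rwa [hexp] at h₁
  -- the set of small `R(n)` is covered by `B₂ ∪ B₁`, by (3.1)
  have hsub : ((Finset.Icc 1 ⌊X⌋₊).filter fun n : ℕ => (1 - ε) * X < n ∧ Even n ∧
      coeffR P X n ≤ X ^ (1 - κ) / 2) ⊆ B₂ ∪ B₁ := by
    intro n hn
    rw [Finset.mem_filter] at hn
    obtain ⟨hnI, hnX, hne, hRn⟩ := hn
    rw [Finset.mem_union]
    by_cases hc : (majorArcIntegral P Q X n).re ≤ X ^ (1 - κ)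
    · left
      rw [hB₂, Finset.mem_filter]
      exact ⟨hnI, hnX, hne, hc⟩
    · right
      rw [hB₁, Finset.mem_filter]
      refine ⟨hnI, ?_⟩
      have hsum := congrArg Complex.re (coeffR_eq_add X n hQ0 hPQ)
      rw [Complex.ofReal_re, Complex.add_re] at hsum
      have h2 : -‖minorArcIntegral P Q X n‖ ≤ (minorArcIntegral P Q X n).re :=
        (abs_le.mp (Complex.abs_re_le_norm _)).1
      have hpos : 0 ≤ X ^ (1 - κ) := Real.rpow_nonneg hX0.le _
      have hc := not_le.mp hc
      linarith
  calc _ ≤ ((B₂ ∪ B₁).card : ℝ) := by exact_mod_cast Finset.card_le_card hsub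
    _ ≤ (B₂.card : ℝ) + B₁.card := by exact_mod_cast Finset.card_union_le B₂ B₁
    _ ≤ C * X ^ σ + X ^ σ := add_le_add hB₂card hB₁card
    _ = (C + 1) * X ^ σ := by ring

/-! ### Input B(σ) from many Goldbach representations off a small set

The weight- and cutoff-free form of the same interface: `R(n) ≥ (log P)² (r(n) - 2(⌊P⌋ + 1))`
with `r(n) = goldbachCount n` the number of ordered prime pairs (`sq_log_mul_sub_le_coeffR`), so
"all but `≤ C X^σ` even `n ∈ ((1-ε)X, X]` have more than `X^{1-κ}` Goldbach representations"
already gives B(σ) (`majorArcLowerBoundOffSmallSet_of_goldbachCount`). This is the form in which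
any treatment of the exceptional set — whatever its weights (`Λ` or `log p`), prime ranges, arcs
and level — can be plugged into the assembly of
`Literature/NumberTheory/Sieve/LuGoldbachExceptionalSet.lean`. -/

/-- **`R(n)` against the representation count.** For `P ≥ 1` and `n ≤ X`, every ordered prime
pair `(p₁, p₂)` with `p₁ + p₂ = n` and `p₁, p₂ > P` lies in the prime window and contributes
`log p₁ log p₂ ≥ (log P)²` to `R(n) = coeffR P X n`, while at most `⌊P⌋ + 1` of the
`goldbachCount n` ordered prime pairs have `p₁ ≤ P` and at most `⌊P⌋ + 1` have `p₂ ≤ P`; hence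
`R(n) ≥ (log P)² (goldbachCount n - 2(⌊P⌋ + 1))`. [folklore] -/
theorem sq_log_mul_sub_le_coeffR {P X : ℝ} (hP : 1 ≤ P) {n : ℕ} (hn : (n : ℝ) ≤ X) :
    Real.log P ^ 2 * ((ParityWave0.goldbachCount n : ℝ) - 2 * (⌊P⌋₊ + 1)) ≤ coeffR P X n := by
  classical
  have hlogP : 0 ≤ Real.log P := Real.log_nonneg hP
  have hP0 : 0 < P := by linarith
  have hnX : n ≤ ⌊X⌋₊ := Nat.le_floor hn
  -- `T`: the ordered prime pairs summing to `n`; `S`: those with both entries `> P`;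
  -- `F₁`, `F₂`: those with a small first, resp. second, entry
  obtain ⟨T, hT⟩ : ∃ T : Finset (ℕ × ℕ),
      T = (Finset.HasAntidiagonal.antidiagonal n).filter
        fun pq : ℕ × ℕ => pq.1.Prime ∧ pq.2.Prime := ⟨_, rfl⟩
  obtain ⟨S, hS⟩ : ∃ S : Finset (ℕ × ℕ),
      S = T.filter fun pq : ℕ × ℕ => P < pq.1 ∧ P < pq.2 := ⟨_, rfl⟩
  obtain ⟨F₁, hF₁⟩ : ∃ F₁ : Finset (ℕ × ℕ),
      F₁ = T.filter fun pq : ℕ × ℕ => ¬ P < pq.1 := ⟨_, rfl⟩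
  obtain ⟨F₂, hF₂⟩ : ∃ F₂ : Finset (ℕ × ℕ),
      F₂ = T.filter fun pq : ℕ × ℕ => ¬ P < pq.2 := ⟨_, rfl⟩
  have hTcard : (ParityWave0.goldbachCount n : ℝ) = T.card := by
    rw [hT]; rfl
  have hmemT : ∀ pq : ℕ × ℕ, pq ∈ T → pq.1 + pq.2 = n ∧ pq.1.Prime ∧ pq.2.Prime := by
    intro pq hpq
    rw [hT, Finset.mem_filter, Finset.HasAntidiagonal.mem_antidiagonal] at hpq
    exact ⟨hpq.1, hpq.2⟩
  -- (i) the pairs with a small entry are few: `#F₁, #F₂ ≤ ⌊P⌋ + 1`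
  have hF₁card : F₁.card ≤ ⌊P⌋₊ + 1 := by
    calc F₁.card ≤ (Finset.range (⌊P⌋₊ + 1)).card := by
          refine Finset.card_le_card_of_injOn Prod.fst (fun pq hpq => ?_) (fun a ha b hb hab => ?_)
          · have hpq' := Finset.mem_filter.mp (hF₁ ▸ Finset.mem_coe.mp hpq)
            exact Finset.mem_coe.mpr (Finset.mem_range.mpr
              (Nat.lt_add_one_iff.mpr (Nat.le_floor (not_lt.mp hpq'.2))))
          · have ha' := (hmemT a (Finset.mem_filter.mp (hF₁ ▸ Finset.mem_coe.mp ha)).1).1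
            have hb' := (hmemT b (Finset.mem_filter.mp (hF₁ ▸ Finset.mem_coe.mp hb)).1).1
            have hab' : a.1 = b.1 := hab
            exact Prod.ext hab' (by omega)
      _ = ⌊P⌋₊ + 1 := Finset.card_range _
  have hF₂card : F₂.card ≤ ⌊P⌋₊ + 1 := by
    calc F₂.card ≤ (Finset.range (⌊P⌋₊ + 1)).card := by
          refine Finset.card_le_card_of_injOn Prod.snd (fun pq hpq => ?_) (fun a ha b hb hab => ?_)
          · have hpq' := Finset.mem_filter.mp (hF₂ ▸ Finset.mem_coe.mp hpq)
            exact Finset.mem_coe.mpr (Finset.mem_range.mpr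
              (Nat.lt_add_one_iff.mpr (Nat.le_floor (not_lt.mp hpq'.2))))
          · have ha' := (hmemT a (Finset.mem_filter.mp (hF₂ ▸ Finset.mem_coe.mp ha)).1).1
            have hb' := (hmemT b (Finset.mem_filter.mp (hF₂ ▸ Finset.mem_coe.mp hb)).1).1
            have hab' : a.2 = b.2 := hab
            exact Prod.ext (by omega) hab'
      _ = ⌊P⌋₊ + 1 := Finset.card_range _
  -- (ii) `T ⊆ S ∪ F₁ ∪ F₂`, so `#T ≤ #S + #F₁ + #F₂`
  have hcover : T ⊆ S ∪ (F₁ ∪ F₂) := by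
    intro pq hpq
    simp only [Finset.mem_union, hS, hF₁, hF₂, Finset.mem_filter]
    by_cases h1 : P < pq.1
    · by_cases h2 : P < pq.2
      · exact Or.inl ⟨hpq, h1, h2⟩
      · exact Or.inr (Or.inr ⟨hpq, h2⟩)
    · exact Or.inr (Or.inl ⟨hpq, h1⟩)
  have hTle : T.card ≤ S.card + (F₁.card + F₂.card) :=
    (Finset.card_le_card hcover).trans
      ((Finset.card_union_le _ _).trans (Nat.add_le_add_left (Finset.card_union_le _ _) _))
  have hcount : (ParityWave0.goldbachCount n : ℝ) - 2 * (⌊P⌋₊ + 1) ≤ S.card := by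
    have h1 : (T.card : ℝ) ≤ S.card + (F₁.card + F₂.card) := by exact_mod_cast hTle
    have h2 : (F₁.card : ℝ) ≤ ⌊P⌋₊ + 1 := by exact_mod_cast hF₁card
    have h3 : (F₂.card : ℝ) ≤ ⌊P⌋₊ + 1 := by exact_mod_cast hF₂card
    rw [hTcard]
    linarith
  -- (iii) every pair of `S` lies in the prime window squared and contributes `≥ (log P)²`
  have hSsub : S ⊆ primeWindow P X ×ˢ primeWindow P X := by
    intro pq hpq
    rw [hS, Finset.mem_filter] at hpq
    obtain ⟨hpqT, hP1, hP2⟩ := hpq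
    obtain ⟨hsum, hp1, hp2⟩ := hmemT pq hpqT
    rw [Finset.mem_product]
    exact ⟨Finset.mem_filter.mpr ⟨Nat.mem_primesLE.mpr ⟨by omega, hp1⟩, hP1⟩,
      Finset.mem_filter.mpr ⟨Nat.mem_primesLE.mpr ⟨by omega, hp2⟩, hP2⟩⟩
  have hprod : coeffR P X n = ∑ x ∈ primeWindow P X ×ˢ primeWindow P X,
      (if x.1 + x.2 = n then Real.log x.1 * Real.log x.2 else 0) :=
    (Finset.sum_product' (primeWindow P X) (primeWindow P X)
      fun p₁ p₂ : ℕ => if p₁ + p₂ = n then Real.log p₁ * Real.log p₂ else (0 : ℝ)).symm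
  have hle : ∑ x ∈ S, (if x.1 + x.2 = n then Real.log x.1 * Real.log x.2 else 0) ≤
      coeffR P X n := by
    rw [hprod]
    refine Finset.sum_le_sum_of_subset_of_nonneg hSsub fun x _ _ => ?_
    split_ifs
    · exact mul_nonneg (Real.log_natCast_nonneg _) (Real.log_natCast_nonneg _)
    · exact le_rfl
  have hSsum : (S.card : ℝ) * Real.log P ^ 2 ≤
      ∑ x ∈ S, (if x.1 + x.2 = n then Real.log x.1 * Real.log x.2 else 0) := by
    rw [← nsmul_eq_mul]
    refine Finset.card_nsmul_le_sum S _ _ fun x hx => ?_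
    rw [hS, Finset.mem_filter] at hx
    obtain ⟨hxT, hP1, hP2⟩ := hx
    obtain ⟨hsum, -, -⟩ := hmemT x hxT
    rw [if_pos hsum, sq]
    have h1 : Real.log P ≤ Real.log (x.1 : ℝ) := Real.log_le_log hP0 hP1.le
    have h2 : Real.log P ≤ Real.log (x.2 : ℝ) := Real.log_le_log hP0 hP2.le
    exact mul_le_mul h1 h2 hlogP (hlogP.trans h1)
  calc Real.log P ^ 2 * ((ParityWave0.goldbachCount n : ℝ) - 2 * (⌊P⌋₊ + 1))
      ≤ Real.log P ^ 2 * S.card := mul_le_mul_of_nonneg_left hcount (sq_nonneg _)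
    _ = (S.card : ℝ) * Real.log P ^ 2 := mul_comm _ _
    _ ≤ _ := hSsum
    _ ≤ coeffR P X n := hle

/-- **B(σ) from many Goldbach representations off a small set.** If for some window ratio
`1 - ε` (`0 < ε ≤ 1/2`), level `0 < θ ≤ 1/4` and saving `κ > 0` with `1 - θ + 2κ < σ` all even
`n ∈ ((1-ε)X, X]` except at most `C X^σ` of them have more than `X^{1-κ}` ordered Goldbach
representations (`goldbachCount n > X^{1-κ}`), `X ≥ X₀`, then `MajorArcLowerBoundOffSmallSet σ`.
For `σ ≥ 1` this is `MajorArcLowerBoundOffSmallSet.of_one_le`; for `σ < 1` (so `κ < θ/2`),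
`goldbachCount n > X^{1-κ}` gives `R(n) ≥ (θ log X)² (goldbachCount n - 2⌊X^θ⌋ - 2) > 2 X^{1-κ}`
once `(θ log X)² ≥ 4` and `4 X^θ + 4 ≤ X^{1-κ}` (`sq_log_mul_sub_le_coeffR`), and
`majorArcLowerBoundOffSmallSet_of_coeffR` applies with the same `ε, θ, κ`. [folklore] -/
theorem majorArcLowerBoundOffSmallSet_of_goldbachCount {σ ε θ κ C X₀ : ℝ} (hε : 0 < ε)
    (hε2 : ε ≤ 1 / 2) (hθ : 0 < θ) (hθ4 : θ ≤ 1 / 4) (hκ : 0 < κ) (hσ : 1 - θ + 2 * κ < σ)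
    (h : ∀ X : ℝ, X₀ ≤ X →
      (((Finset.Icc 1 ⌊X⌋₊).filter fun n : ℕ => (1 - ε) * X < n ∧ Even n ∧
          (ParityWave0.goldbachCount n : ℝ) ≤ X ^ (1 - κ)).card : ℝ) ≤ C * X ^ σ) :
    MajorArcLowerBoundOffSmallSet σ := by
  -- for `σ ≥ 1` there is nothing to prove
  rcases le_or_gt 1 σ with hσ1 | hσ1
  · exact MajorArcLowerBoundOffSmallSet.of_one_le hσ1
  -- now `κ < θ / 2`, so `d = 1 - κ - θ > 0`
  have hd : 0 < 1 - κ - θ := by linarith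
  -- `X₂`: beyond it `(θ log X)² ≥ 4` and `X^{1-κ-θ} ≥ 8`
  set X₂ : ℝ := max (Real.exp (2 / θ)) ((8 : ℝ) ^ (1 / (1 - κ - θ))) with hX₂
  refine majorArcLowerBoundOffSmallSet_of_coeffR (C := C) (X₀ := max X₀ (max X₂ 1)) hε hε2 hθ
    hθ4 hκ hσ fun X hX => ?_
  have hXX₀ : X₀ ≤ X := (le_max_left _ _).trans hX
  have hXX₂ : X₂ ≤ X := ((le_max_left _ _).trans (le_max_right _ _)).trans hX
  have hX1 : 1 ≤ X := ((le_max_right _ _).trans (le_max_right _ _)).trans hX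
  have hX0 : 0 < X := by linarith
  -- `(θ log X)² ≥ 4`
  have hlog4 : 4 ≤ (θ * Real.log X) ^ 2 := by
    have hlogX : 2 / θ ≤ Real.log X :=
      (Real.le_log_iff_exp_le hX0).mpr ((le_max_left _ _).trans hXX₂)
    have h2 : 2 ≤ θ * Real.log X := by
      calc (2 : ℝ) = θ * (2 / θ) := by field_simp
        _ ≤ θ * Real.log X := mul_le_mul_of_nonneg_left hlogX hθ.le
    nlinarith
  -- `4 X^θ + 4 ≤ X^{1-κ}`
  have hsmallP : 4 * X ^ θ + 4 ≤ X ^ (1 - κ) := by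
    have h8 : (8 : ℝ) ≤ X ^ (1 - κ - θ) := by
      calc (8 : ℝ) = ((8 : ℝ) ^ (1 / (1 - κ - θ))) ^ (1 - κ - θ) := by
            rw [← Real.rpow_mul (by norm_num), one_div_mul_cancel hd.ne', Real.rpow_one]
        _ ≤ X ^ (1 - κ - θ) :=
            Real.rpow_le_rpow (Real.rpow_nonneg (by norm_num) _)
              ((le_max_right _ _).trans hXX₂) hd.le
    have hPθ : 1 ≤ X ^ θ := Real.one_le_rpow hX1 hθ.le
    have hsplit : X ^ (1 - κ) = X ^ θ * X ^ (1 - κ - θ) := by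
      rw [← Real.rpow_add hX0]; ring_nf
    rw [hsplit]
    nlinarith
  -- few representations ⊇ small `R(n)`, inside the window
  have hsub : ((Finset.Icc 1 ⌊X⌋₊).filter fun n : ℕ => (1 - ε) * X < n ∧ Even n ∧
        coeffR (X ^ θ) X n ≤ 2 * X ^ (1 - κ)) ⊆
      ((Finset.Icc 1 ⌊X⌋₊).filter fun n : ℕ => (1 - ε) * X < n ∧ Even n ∧
        (ParityWave0.goldbachCount n : ℝ) ≤ X ^ (1 - κ)) := by
    intro n hn
    rw [Finset.mem_filter] at hn ⊢
    obtain ⟨hnI, hnX, hne, hRn⟩ := hn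
    refine ⟨hnI, hnX, hne, ?_⟩
    by_contra hgc
    have hgc := not_le.mp hgc
    have hnle : (n : ℝ) ≤ X :=
      (Nat.cast_le.mpr (Finset.mem_Icc.mp hnI).2).trans (Nat.floor_le hX0.le)
    have hkey := sq_log_mul_sub_le_coeffR (Real.one_le_rpow hX1 hθ.le) hnle
    rw [Real.log_rpow hX0] at hkey
    have hfl : (⌊X ^ θ⌋₊ : ℝ) ≤ X ^ θ := Nat.floor_le (Real.rpow_nonneg hX0.le _)
    have hb : X ^ (1 - κ) / 2 <
        (ParityWave0.goldbachCount n : ℝ) - 2 * (⌊X ^ θ⌋₊ + 1) := by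
      linarith
    have hb0 : 0 ≤ (ParityWave0.goldbachCount n : ℝ) - 2 * (⌊X ^ θ⌋₊ + 1) := by
      have : 0 ≤ X ^ (1 - κ) := Real.rpow_nonneg hX0.le _
      linarith
    have h4 : 4 * ((ParityWave0.goldbachCount n : ℝ) - 2 * (⌊X ^ θ⌋₊ + 1)) ≤
        (θ * Real.log X) ^ 2 * ((ParityWave0.goldbachCount n : ℝ) - 2 * (⌊X ^ θ⌋₊ + 1)) :=
      mul_le_mul_of_nonneg_right hlog4 hb0
    linarith
  calc _ ≤ ((((Finset.Icc 1 ⌊X⌋₊).filter fun n : ℕ => (1 - ε) * X < n ∧ Even n ∧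
          (ParityWave0.goldbachCount n : ℝ) ≤ X ^ (1 - κ)).card : ℕ) : ℝ) := by
        exact_mod_cast Finset.card_le_card hsub
    _ ≤ C * X ^ σ := h X hXX₀

/-- The level-free form of `majorArcLowerBoundOffSmallSet_of_goldbachCount` (take `θ = 1/4`, the
representation count not involving the level): if `0 < ε ≤ 1/2`, `κ > 0`, `3/4 + 2κ < σ` and for
`X ≥ X₀` all even `n ∈ ((1-ε)X, X]` but at most `C X^σ` have more than `X^{1-κ}` ordered Goldbach
representations, then `MajorArcLowerBoundOffSmallSet σ`. [folklore] -/
theorem majorArcLowerBoundOffSmallSet_of_goldbachCount_quarter {σ ε κ C X₀ : ℝ} (hε : 0 < ε)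
    (hε2 : ε ≤ 1 / 2) (hκ : 0 < κ) (hσ : 3 / 4 + 2 * κ < σ)
    (h : ∀ X : ℝ, X₀ ≤ X →
      (((Finset.Icc 1 ⌊X⌋₊).filter fun n : ℕ => (1 - ε) * X < n ∧ Even n ∧
          (ParityWave0.goldbachCount n : ℝ) ≤ X ^ (1 - κ)).card : ℝ) ≤ C * X ^ σ) :
    MajorArcLowerBoundOffSmallSet σ :=
  majorArcLowerBoundOffSmallSet_of_goldbachCount (θ := 1 / 4) hε hε2 (by norm_num) le_rfl hκ
    (by linarith) h

/-- **The representation count against `R(n)`.** For `X ≥ 1`, every term `log p₁ log p₂` of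
`R(n) = coeffR P X n` (`p₁, p₂ ≤ X` primes, `p₁ + p₂ = n`) is at most `(log X)²` and belongs to a
distinct ordered Goldbach representation of `n`; so `R(n) ≤ (log X)² goldbachCount n`. [folklore] -/
theorem coeffR_le_sq_log_mul {P X : ℝ} (hX : 1 ≤ X) (n : ℕ) :
    coeffR P X n ≤ Real.log X ^ 2 * ParityWave0.goldbachCount n := by
  classical
  have hX0 : 0 < X := by linarith
  -- bound each term by `(log X)²` on the pairs summing to `n`, by `0` elsewhere
  have hterm : ∀ x ∈ primeWindow P X ×ˢ primeWindow P X,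
      (if x.1 + x.2 = n then Real.log x.1 * Real.log x.2 else 0) ≤
        if x.1 + x.2 = n then Real.log X ^ 2 else 0 := by
    intro x hx
    rw [Finset.mem_product] at hx
    obtain ⟨h1, h2⟩ := hx
    have hp1 := (Nat.mem_primesLE.mp (Finset.mem_filter.mp h1).1)
    have hp2 := (Nat.mem_primesLE.mp (Finset.mem_filter.mp h2).1)
    split_ifs
    · have hx1 : (1 : ℝ) ≤ x.1 := by exact_mod_cast hp1.2.one_lt.le
      have hx2 : (1 : ℝ) ≤ x.2 := by exact_mod_cast hp2.2.one_lt.le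
      have hx1X : (x.1 : ℝ) ≤ X := (Nat.cast_le.mpr hp1.1).trans (Nat.floor_le hX0.le)
      have hx2X : (x.2 : ℝ) ≤ X := (Nat.cast_le.mpr hp2.1).trans (Nat.floor_le hX0.le)
      have hl1 : Real.log x.1 ≤ Real.log X := Real.log_le_log (by linarith) hx1X
      have hl2 : Real.log x.2 ≤ Real.log X := Real.log_le_log (by linarith) hx2X
      rw [sq]
      exact mul_le_mul hl1 hl2 (Real.log_nonneg hx2) ((Real.log_nonneg hx1).trans hl1)
    · exact le_rfl
  -- the pairs summing to `n` are ordered Goldbach representations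
  have hsub : ((primeWindow P X ×ˢ primeWindow P X).filter fun x : ℕ × ℕ => x.1 + x.2 = n) ⊆
      (Finset.HasAntidiagonal.antidiagonal n).filter
        fun pq : ℕ × ℕ => pq.1.Prime ∧ pq.2.Prime := by
    intro x hx
    rw [Finset.mem_filter, Finset.mem_product] at hx
    obtain ⟨⟨h1, h2⟩, hsum⟩ := hx
    rw [Finset.mem_filter, Finset.HasAntidiagonal.mem_antidiagonal]
    exact ⟨hsum, (Nat.mem_primesLE.mp (Finset.mem_filter.mp h1).1).2,
      (Nat.mem_primesLE.mp (Finset.mem_filter.mp h2).1).2⟩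
  have hcard : ((((primeWindow P X ×ˢ primeWindow P X).filter
      fun x : ℕ × ℕ => x.1 + x.2 = n).card : ℕ) : ℝ) ≤ ParityWave0.goldbachCount n := by
    exact_mod_cast Finset.card_le_card hsub
  calc coeffR P X n
      = ∑ x ∈ primeWindow P X ×ˢ primeWindow P X,
          (if x.1 + x.2 = n then Real.log x.1 * Real.log x.2 else 0) :=
        (Finset.sum_product' (primeWindow P X) (primeWindow P X)
          fun p₁ p₂ : ℕ => if p₁ + p₂ = n then Real.log p₁ * Real.log p₂ else (0 : ℝ)).symm
    _ ≤ ∑ x ∈ primeWindow P X ×ˢ primeWindow P X,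
          (if x.1 + x.2 = n then Real.log X ^ 2 else 0) := Finset.sum_le_sum hterm
    _ = Real.log X ^ 2 * (((primeWindow P X ×ˢ primeWindow P X).filter
          fun x : ℕ × ℕ => x.1 + x.2 = n).card : ℕ) := by
        rw [Finset.sum_ite, Finset.sum_const, Finset.sum_const_zero, add_zero, nsmul_eq_mul,
          mul_comm]
    _ ≤ Real.log X ^ 2 * ParityWave0.goldbachCount n :=
        mul_le_mul_of_nonneg_left hcard (sq_nonneg _)

/-- **Many Goldbach representations off a small set, from B(σ)** (the converse of
`majorArcLowerBoundOffSmallSet_of_goldbachCount_quarter`): if `MajorArcLowerBoundOffSmallSet σ`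
holds then there are `0 < ε ≤ 1/2` and `κ > 0` with `3/4 + 2κ < σ` such that for `X ≥ X₀` all
even `n ∈ ((1-ε)X, X]` but at most `C X^σ` of them have more than `X^{1-κ}` ordered Goldbach
representations. From `MajorArcLowerBoundOffSmallSet.coeffR_lowerBound` (`R(n) > X^{1-κ₀}/2` off
the small set, `κ₀` the saving of B(σ)) and `coeffR_le_sq_log_mul`
(`R(n) ≤ (log X)² goldbachCount n`), with any `κ₀ < κ`, `3/4 + 2κ < σ`, once
`2 (log X)² ≤ X^{κ-κ₀}`. [folklore] -/
theorem MajorArcLowerBoundOffSmallSet.goldbachCount_lowerBound {σ : ℝ}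
    (hB : MajorArcLowerBoundOffSmallSet σ) :
    ∃ ε κ : ℝ, 0 < ε ∧ ε ≤ 1 / 2 ∧ 0 < κ ∧ 3 / 4 + 2 * κ < σ ∧
      ∃ C X₀ : ℝ, ∀ X : ℝ, X₀ ≤ X →
        (((Finset.Icc 1 ⌊X⌋₊).filter fun n : ℕ => (1 - ε) * X < n ∧ Even n ∧
            (ParityWave0.goldbachCount n : ℝ) ≤ X ^ (1 - κ)).card : ℝ) ≤ C * X ^ σ := by
  obtain ⟨ε, θ, κ₀, hε, hε2, hθ, hθ4, hκ₀, hσ, C, X₀, hBX⟩ := hB.coeffR_lowerBound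
  -- a slightly larger `κ`, still admissible
  set κ : ℝ := κ₀ + (σ - (1 - θ + 2 * κ₀)) / 4 with hκ
  have hκ₀κ : κ₀ < κ := by rw [hκ]; linarith
  have hσκ : 3 / 4 + 2 * κ < σ := by rw [hκ]; linarith
  have hd : 0 < (κ - κ₀) / 2 := by linarith
  -- `X₃`: beyond it `log X ≤ X^{(κ-κ₀)/2} / 2`, so `2 (log X)² ≤ X^{κ-κ₀}`
  obtain ⟨X₃, hX₃⟩ := Filter.eventually_atTop.mp
    ((isLittleO_log_rpow_atTop hd).def (by norm_num : (0 : ℝ) < 1 / 2))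
  refine ⟨ε, κ, hε, hε2, hκ₀.trans hκ₀κ, hσκ, C, max X₀ (max X₃ 1), fun X hX => ?_⟩
  have hXX₀ : X₀ ≤ X := (le_max_left _ _).trans hX
  have hXX₃ : X₃ ≤ X := ((le_max_left _ _).trans (le_max_right _ _)).trans hX
  have hX1 : 1 ≤ X := ((le_max_right _ _).trans (le_max_right _ _)).trans hX
  have hX0 : 0 < X := by linarith
  -- `(log X)² X^{1-κ} ≤ X^{1-κ₀} / 2`
  have hlog : Real.log X ≤ 1 / 2 * X ^ ((κ - κ₀) / 2) := by
    have h := hX₃ X hXX₃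
    rwa [Real.norm_of_nonneg (Real.log_nonneg hX1),
      Real.norm_of_nonneg (Real.rpow_nonneg hX0.le _)] at h
  have hlog2 : 2 * Real.log X ^ 2 ≤ X ^ (κ - κ₀) := by
    have hl0 : 0 ≤ Real.log X := Real.log_nonneg hX1
    have hsq : Real.log X ^ 2 ≤ (1 / 2 * X ^ ((κ - κ₀) / 2)) ^ 2 := pow_le_pow_left₀ hl0 hlog 2
    have hmul : X ^ ((κ - κ₀) / 2) * X ^ ((κ - κ₀) / 2) = X ^ (κ - κ₀) := by
      rw [← Real.rpow_add hX0]; ring_nf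
    nlinarith [Real.rpow_nonneg hX0.le (κ - κ₀)]
  have hthr : Real.log X ^ 2 * X ^ (1 - κ) ≤ X ^ (1 - κ₀) / 2 := by
    have hsplit : X ^ (1 - κ₀) = X ^ (κ - κ₀) * X ^ (1 - κ) := by
      rw [← Real.rpow_add hX0]; ring_nf
    rw [hsplit, le_div_iff₀ two_pos]
    have hpos : 0 ≤ X ^ (1 - κ) := Real.rpow_nonneg hX0.le _
    nlinarith
  -- few representations ⇒ small `R(n)`
  have hsub : ((Finset.Icc 1 ⌊X⌋₊).filter fun n : ℕ => (1 - ε) * X < n ∧ Even n ∧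
        (ParityWave0.goldbachCount n : ℝ) ≤ X ^ (1 - κ)) ⊆
      ((Finset.Icc 1 ⌊X⌋₊).filter fun n : ℕ => (1 - ε) * X < n ∧ Even n ∧
        coeffR (X ^ θ) X n ≤ X ^ (1 - κ₀) / 2) := by
    intro n hn
    rw [Finset.mem_filter] at hn ⊢
    obtain ⟨hnI, hnX, hne, hgc⟩ := hn
    refine ⟨hnI, hnX, hne, ?_⟩
    calc coeffR (X ^ θ) X n ≤ Real.log X ^ 2 * ParityWave0.goldbachCount n :=
          coeffR_le_sq_log_mul hX1 n
      _ ≤ Real.log X ^ 2 * X ^ (1 - κ) := mul_le_mul_of_nonneg_left hgc (sq_nonneg _)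
      _ ≤ X ^ (1 - κ₀) / 2 := hthr
  calc _ ≤ ((((Finset.Icc 1 ⌊X⌋₊).filter fun n : ℕ => (1 - ε) * X < n ∧ Even n ∧
          coeffR (X ^ θ) X n ≤ X ^ (1 - κ₀) / 2).card : ℕ) : ℝ) := by
        exact_mod_cast Finset.card_le_card hsub
    _ ≤ C * X ^ σ := hBX X hXX₀

/-- **What input B(σ) says, arithmetically.** `MajorArcLowerBoundOffSmallSet σ` holds if and only
if there are a window ratio `1 - ε` (`0 < ε ≤ 1/2`) and a saving `κ > 0` with `3/4 + 2κ < σ` such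
that for `X ≥ X₀` all even `n ∈ ((1-ε)X, X]` except at most `C X^σ` of them have more than
`X^{1-κ}` ordered Goldbach representations. In particular input B at `σ = 0.879` (the hypothesis
of `Literature.NumberTheory.Sieve.goldbachExceptionalCount_isBigO_rpow_lu_of_majorArc`) is Lu's theorem
`E(x) ≪ x^{0.879}` [LuJNT2010] in quantitative form (a power of `X` representations off the
exceptional set, the form in which the circle method delivers such theorems: Li 2000, §6 with
Lemma 7 [Li2000]), and no feature of the Montgomery–Vaughan arc dissection survives in it.
[folklore] -/
theorem majorArcLowerBoundOffSmallSet_iff_goldbachCount (σ : ℝ) :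
    MajorArcLowerBoundOffSmallSet σ ↔
      ∃ ε κ : ℝ, 0 < ε ∧ ε ≤ 1 / 2 ∧ 0 < κ ∧ 3 / 4 + 2 * κ < σ ∧
        ∃ C X₀ : ℝ, ∀ X : ℝ, X₀ ≤ X →
          (((Finset.Icc 1 ⌊X⌋₊).filter fun n : ℕ => (1 - ε) * X < n ∧ Even n ∧
              (ParityWave0.goldbachCount n : ℝ) ≤ X ^ (1 - κ)).card : ℝ) ≤ C * X ^ σ :=
  ⟨MajorArcLowerBoundOffSmallSet.goldbachCount_lowerBound,
    fun ⟨_, _, hε, hε2, hκ, hσ, _, _, h⟩ =>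
      majorArcLowerBoundOffSmallSet_of_goldbachCount_quarter hε hε2 hκ hσ h⟩

end Literature.NumberTheory.Sieve.Lu2010
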